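import Summits.ResolutionOfSingularities.ResolutionOfSingularities.Theorems.AQSHeightTwoLexMaxGerm
import Summits.ResolutionOfSingularities.ResolutionOfSingularities.Theorems.AQSHeightTwoTopOpenWrapper
import Summits.ResolutionOfSingularities.ResolutionOfSingularities.Theorems.AQSHeightTwoPlusStalkPoint
import Summits.ResolutionOfSingularities.ResolutionOfSingularities.Theorems.AQSHeightTwoOrderReadOff
import Summits.ResolutionOfSingularities.ResolutionOfSingularities.Theorems.WeightedInvariantLexMaxCentreGlobal
import Summits.ResolutionOfSingularities.ResolutionOfSingularities.Theorems.WeightedInvariantLexMaxOrderDropOrder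
import Summits.ResolutionOfSingularities.ResolutionOfSingularities.Theorems.RadicialJungCleanModelsStubFormalFibreReducedStalk
import HarnessLib

/-!
# Abramovich–Quek–Schober at a height-two point, V: the named fact `AbramovichQuekSchober2025_heightTwoCentre` HOLDS

Topic: `Summits/ResolutionOfSingularities/ResolutionOfSingularities/Theorems`. Helper for the door item
`HypersurfaceCentreConstruction` (statement `stmt-ResolutionOfSingularities-19897`, route `WeightedInvariant`), line
`local-engine`, ORDER (o25) «F-AQS-T in the kernel» of `res-L1-w43-plan-1` (2026-08-27T09:19:49Z) — the ASSEMBLY of the (o25)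
team's pieces (lead res-type-092; design memo `plan/tools/res-type-092/o25/O25-DESIGN.md`):

* (α) the local lex-maximal centre germ — `AQSHeightTwo.exists_isLexMaxWeightedCentreGerm` (res-type-092, files
  `AQSHeightTwoSlopeFiltration` / `…SlopeCompare` / `…SlopeCaseC` / `…LexMaxGerm`; res-D-pv-023's `AQSHeightTwoSlope`;
  res-type-070's `AQSHeightTwoWeightedContactUnique`);
* (β) the local order drop for the lex-max weights — `LexMaxOrderDrop.adicOrder_transform_lt_of_isLexMax` (res-type-098,
  files `WeightedInvariantLexMaxOrderDrop{Face,Competitor,,Order}`);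
* (γ1) the chart and the Rees algebra on `Y` — `LexMaxCentreGlobal.exists_isWeightedChart_and_support_ofGermFiltration`
  (res-type-047, over res-D-pv-025's `ReesAlgebraData.ofGermFiltration`);
* (γ2) the `B₊(U)`-stalk read-off — `ReesAlgebraData.IsWeightedChart.exists_gameSide_prime_factorisation_of_not_mem_pow`
  (res-type-089, bricks by res-type-057: `AQSHeightTwoPlusStalk{Affine,,Factor,Point}`, `AQSHeightTwoOrderReadOff`);
* (γ3) the `V := ⊤` wrapper — `AQSHeightTwo.heightTwoCentre_of_onScheme` (`AQSHeightTwoTopOpenWrapper`).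

[OURS · L1 W4.3] The DISCHARGE of a Literature named fact (pattern of `Hironaka2005.FinitePresentationTheorem_holds`): after this
file the e-ladder rung `e = 1` of the door (`ELadderOne.admissiblyResolvableDim_one_of_AQS`, p520391) no longer depends on the
hypothesis `hAQS₁`.  NOT a statement of the manuscript under review (Hironaka 2017); nothing here is a claim about resolution of
singularities in positive characteristic beyond what the kernel checks.  AI work, weaker than expert review.  Def-free.

## References

* D. Abramovich, M. H. Quek, B. Schober, *Torus actions, weighted blow-ups, and desingularization of plane curves*,
  arXiv:2507.01232v3 (accepted, Math. Scand.), Thm 1.3 (1)(3), Def. 3.2–3.3, Thm 3.5, §4, §5 (p. 12 L37–L58).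
  [AbramovichQuekSchober2025]
* J. Włodarczyk, *Functorial resolution by torus actions*, arXiv:2203.03090, Def. 2.3.5, 3.3.12. [Wlodarczyk2022]
-/

noncomputable section

open IsLocalRing Literature.AlgebraicGeometry.Resolution
open CategoryTheory AlgebraicGeometry TopologicalSpace

set_option linter.dupNamespace false -- mandated namespace of this single-conjunct summit

namespace Summit.ResolutionOfSingularities.ResolutionOfSingularities.Theorems

namespace AQSHeightTwo

/-- **The on-scheme package** (the hypothesis `H` of `heightTwoCentre_of_onScheme`): for `Y` locally of finite type over a field
`k`, an ideal sheaf `X` and a point `η` with `𝒪_{Y,η}` regular of dimension `2`, `X_η` principal, non-zero and not `(y^ν)` for a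
regular parameter `y`: a Rees algebra `R` ON `Y`, an affine `U ∋ η` with a weighted chart `(u; w)` whose germs at `η` form the
lex-maximal admissible weighted centre germ of `X_η` with `ℓ / w 0 = ord_η X`, `R.support = closure {η}`, and the ORDER DROP at
every point of `B₊(U)` over `η`. [cite: AbramovichQuekSchober2025, Thm 1.3 (1)(3), Thm 3.5, §4] -/
theorem heightTwoCentre_onScheme (k : Type) [Field k] (Y : Scheme.{0}) (f : Y ⟶ Spec (.of k)) [LocallyOfFiniteType f]
    (X : Y.IdealSheafData) (η : Y) (hreg : IsRegularLocalRing (Y.presheaf.stalk η))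
    (hdim : ringKrullDim (Y.presheaf.stalk η) = ((2 : ℕ) : WithBot ℕ∞))
    (hprinc : (stalkIdeal X η).IsPrincipal) (hne : stalkIdeal X η ≠ ⊥)
    (hny : ∀ y : Y.presheaf.stalk η, y ∈ maximalIdeal (Y.presheaf.stalk η) →
      y ∉ maximalIdeal (Y.presheaf.stalk η) ^ 2 → ∀ ν : ℕ, stalkIdeal X η ≠ Ideal.span {y ^ ν}) :
    ∃ (R : ReesAlgebraData Y) (U : Y.affineOpens) (hηU : η ∈ (U : Y.Opens)) (u : Fin 2 → Γ(Y, U))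
      (w : Fin 2 → ℕ) (ℓ : ℕ),
      R.IsWeightedChart U u w ∧
      IsLexMaxWeightedCentreGerm (Y.presheaf.stalk η) (stalkIdeal X η)
        (fun i => (Y.presheaf.germ (U : Y.Opens) η hηU).hom (u i)) w ℓ ∧
      (((ℓ / w 0 : ℕ) : ℕ∞) = idealOrder X η) ∧
      (R.support = closure {η}) ∧
      ∀ b : R.cobordantPlus U, R.cobordantPlusι U b = η →
        idealOrder (R.cobordantStrictTransform U X) b < idealOrder X η := by
  classical
  haveI := hreg
  -- `𝒪_{Y,η}` is essentially of finite type over `k`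
  obtain ⟨algk, hess⟩ := RadicialJung.CleanModels.exists_algebra_essFiniteType_stalk k Y f η
  letI := algk
  haveI := hess
  -- a generator `g` of the stalk
  obtain ⟨g, hg⟩ := hprinc
  have hg' : stalkIdeal X η = Ideal.span {g} := hg
  have hg0 : g ≠ 0 := by
    rintro rfl
    exact hne (by rw [hg', Ideal.span_singleton_eq_bot])
  have hny' : ∀ y : Y.presheaf.stalk η, y ∈ maximalIdeal (Y.presheaf.stalk η) →
      y ∉ maximalIdeal (Y.presheaf.stalk η) ^ 2 → ∀ ν : ℕ, Ideal.span {g} ≠ Ideal.span {y ^ ν} := by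
    rw [← hg']; exact hny
  have hdim2 : ringKrullDim (Y.presheaf.stalk η) = 2 := by rw [hdim]; rfl
  -- (α): the lex-maximal germ
  obtain ⟨x, y, q, r, ν, hν2, hgν, hgν', hq, hqr, hxy, hlex⟩ :=
    exists_isLexMaxWeightedCentreGerm (Y.presheaf.stalk η) k hdim2 g hg0 hny'
  have hr0 : 0 < r := lt_of_lt_of_le hq hqr
  have hX : Ideal.span (Set.range ![y, x]) = maximalIdeal (Y.presheaf.stalk η) := hlex.1
  have hw : ∀ i, 0 < (![r, q] : Fin 2 → ℕ) i := hlex.2.1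
  have hxm : ∀ i, ![y, x] i ∈ maximalIdeal (Y.presheaf.stalk η) := fun i =>
    hX ▸ Ideal.subset_span (Set.mem_range_self i)
  have h0 : weightedMonomialIdeal ![y, x] ![r, q] 0 = ⊤ := weightedMonomialIdeal_zero _ _
  have hmul : ∀ a b, weightedMonomialIdeal ![y, x] ![r, q] a * weightedMonomialIdeal ![y, x] ![r, q] b ≤
      weightedMonomialIdeal ![y, x] ![r, q] (a + b) := weightedMonomialIdeal_mul_le _ _
  have hprim : ∀ n, ∃ N : ℕ, maximalIdeal (Y.presheaf.stalk η) ^ N ≤ weightedMonomialIdeal ![y, x] ![r, q] n :=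
    fun n => ⟨n, pow_le_weightedMonomialIdeal_of_span_eq _ _ hw hX n⟩
  -- (γ1): the chart and the Rees algebra on `Y`
  obtain ⟨U, hηU, u, hgerm, hchart, hsupp⟩ :=
    LexMaxCentreGlobal.exists_isWeightedChart_and_support_ofGermFiltration f η hdim ![y, x] hX ![r, q] hw h0 hmul hprim
  -- the order of `X` at `η`
  have hordg : adicOrder g = (ν : ℕ∞) :=
    le_antisymm ((adicOrder_le_iff g ν).mpr hgν') ((le_adicOrder_iff g ν).mpr hgν)
  have hordX : idealOrder X η = (ν : ℕ∞) := by rw [idealOrder_eq_adicOrder_of_stalkIdeal_eq_span X η hg', hordg]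
  have hgermfun : (fun i => (Y.presheaf.germ (U : Y.Opens) η hηU).hom (u i)) = ![y, x] := funext hgerm
  refine ⟨_, U, hηU, u, ![r, q], r * ν, hchart, ?_, ?_, hsupp, fun b hb => ?_⟩
  · rw [hgermfun, hg']; exact hlex
  · have e : r * ν / (![r, q] : Fin 2 → ℕ) 0 = ν := by simp [Nat.mul_div_cancel_left ν hr0]
    rw [e, hordX]
  · -- (γ2): the game-side prime with a primitive factorisation and the order read-off
    obtain ⟨𝔫, h𝔫, hT, hM, hV, a, g', hfg, hndvd, hle⟩ :=
      hchart.exists_gameSide_prime_factorisation_of_not_mem_pow _ U hηU hgerm hxm X hg' hgν' hr0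
        (Fin.forall_fin_two.2 ⟨by simp, by simpa using hqr⟩) b hb
    -- (β): the local order drop
    have hlt := LexMaxOrderDrop.adicOrder_transform_lt_of_isLexMax hdim2 hlex (by simp) hν2 hordg 𝔫 hT hM hV a g' hfg hndvd
    rw [hordX]
    exact lt_of_le_of_lt hle hlt

/-- **NAMED FACT DISCHARGED — Abramovich–Quek–Schober 2025, Thm 1.3 (1)(3) at a point of height two, with Thm 3.5.**
`AbramovichQuekSchober2025_heightTwoCentre` (`Literature/AlgebraicGeometry/Resolution/HypersurfaceHeightTwoWeightedCentre.lean`)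
holds: the (o25) team's on-scheme package through the `V := ⊤` wrapper.
[cite: AbramovichQuekSchober2025, Thm 1.3 (1)(3), Thm 3.5, §4–§5] -/
theorem AbramovichQuekSchober2025_heightTwoCentre_holds : AbramovichQuekSchober2025_heightTwoCentre :=
  heightTwoCentre_of_onScheme fun k _ Y f _ X η hreg hdim hprinc hne hny =>
    heightTwoCentre_onScheme k Y f X η hreg hdim hprinc hne hny

end AQSHeightTwo

end Summit.ResolutionOfSingularities.ResolutionOfSingularities.Theorems

end
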